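import Summits.HodgeConjecture.CorCM.Census.DecicWeil23MultiParts
import HarnessLib

/-!
# ANY NUMBER `r` of `(2,3)`-types over one decic CM field: EXTRACTION of a generating part from a balanced configuration of
# `E × B₁ × ⋯ × B_r` and the INDUCTION PRINCIPLE

COR-CM (cell `pub-hodgecm2`), seat b30 gen 24 (2026-08-22); count-neutral own lane DECIC-MULTI, part 4; sequel of
`Census/DecicWeil23Multi{,Defect,Parts}.lean` (model, DEFECT LAW under `2`-transitivity + independence, the part predicates
`IsPairPartM`, `IsSixPartM`, `IsTenPartM`, their balance at every permutation and selection from the counts).  Theorems only of a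
finite model; no definition, no named fact, no geometry, no `sorry`, no `decide`.  The slot-generic twin of
`Census/DecicWeil23TripleExtraction`.

RESULTS (kernel).  Elementary properties of sixfold and tenfold parts (`mem_cases`, `injOn`, `nonempty`);
`exists_sixPartM_of_counts`, `exists_tenPartM_of_counts`; **EXTRACTION** `exists_part_of_modelBalancedM` — under `#I_m = 2`,
`IndepPos P`, `R` closed under composition and `2`-transitive, a non-empty `R`-balanced configuration contains a pair part, a sixfold
part or a tenfold part (by the defect law `d_{m,a} = t_m`, `e = Σ_m t_m`: two defects of strictly opposite signs ⇒ a tenfold part;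
else all non-zero `t_m` share the sign of `e` ⇒ a sixfold part; all `t_m = 0` ⇒ `e = 0` ⇒ conjugation-invariant counts ⇒ a pair part);
**INDUCTION PRINCIPLE** `modelBalancedM_induction` — a property of configurations that holds for `∅` and is stable under adjoining a
disjoint pair, sixfold or tenfold part holds for every `R`-balanced configuration (any number of copies of `E, B₁, …, B_r`).
[cite: Pohlmann1968, Thm 1] [cite: GaoUllmo2025, Thm 3.1] [cite: Milne2020HodgeClassesAV, 1.2 (a) and Thm. 1]
[cite: MoonenZarhin1995Duke, Thm. 2.4]

## References
* [Pohlmann1968] Ann. of Math. 88 (1968), Thm 1.  [GaoUllmo2025] J. Inst. Math. Jussieu 25 (2025), Thm 3.1.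
  [Milne2020HodgeClassesAV] arXiv:2010.08857, 1.2 (a), Thm. 1.  [MoonenZarhin1995Duke] Duke Math. J. 77 (1995), Thm. 2.4.
-/

namespace Summit.HodgeConjecture.CorCM.Census.DecicWeil23Multi

open Finset

variable {r : ℕ} {α : Type*} {P : Fin r → Fin 5 → Bool} {R : Finset (Equiv.Perm (Fin 5))} {v : α → PtM r}

/-! ### Elementary properties of the sixfold and tenfold parts -/

/-- Every point of a sixfold part lies over `inl b` or over a label `(m, a, b)`. [folklore] -/
theorem IsSixPartM.mem_cases {m : Fin r} {b : Bool} {G : Finset α} (hG : IsSixPartM v m b G) {x : α} (hx : x ∈ G) :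
    v x = Sum.inl b ∨ ∃ a : Fin 5, v x = Sum.inr (m, (a, b)) := by
  classical
  have hpos : 0 < (G.filter fun x' => v x' = v x).card := Finset.card_pos.2 ⟨x, Finset.mem_filter.2 ⟨hx, rfl⟩⟩
  rw [hG.count_eq] at hpos
  by_contra h
  push Not at h
  rw [if_neg h.1, if_neg (fun ⟨a, ha⟩ => h.2 a ha)] at hpos
  exact lt_irrefl 0 hpos

/-- The model map is injective on a sixfold part (one point over each of its six labels). [folklore] -/
theorem IsSixPartM.injOn {m : Fin r} {b : Bool} {G : Finset α} (hG : IsSixPartM v m b G) : Set.InjOn v ↑G := by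
  classical
  intro x hx x' hx' h
  have hle : (G.filter fun y => v y = v x).card ≤ 1 := by
    rw [hG.count_eq]; split_ifs <;> omega
  exact Finset.card_le_one.1 hle x (Finset.mem_filter.2 ⟨hx, rfl⟩) x' (Finset.mem_filter.2 ⟨hx', h.symm⟩)

/-- A sixfold part is non-empty. [folklore] -/
theorem IsSixPartM.nonempty {m : Fin r} {b : Bool} {G : Finset α} (hG : IsSixPartM v m b G) : G.Nonempty := by
  rw [← Finset.card_pos, hG.1]; norm_num

/-- Every point of a tenfold part lies over a label `(m, a, true)` or `(m', a, false)`. [folklore] -/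
theorem IsTenPartM.mem_cases {m m' : Fin r} {G : Finset α} (hG : IsTenPartM v m m' G) {x : α} (hx : x ∈ G) :
    (∃ a : Fin 5, v x = Sum.inr (m, (a, true))) ∨ ∃ a : Fin 5, v x = Sum.inr (m', (a, false)) := by
  classical
  have hpos : 0 < (G.filter fun x' => v x' = v x).card := Finset.card_pos.2 ⟨x, Finset.mem_filter.2 ⟨hx, rfl⟩⟩
  rw [hG.count_eq] at hpos
  by_contra h
  rw [if_neg h] at hpos
  exact lt_irrefl 0 hpos

/-- The model map is injective on a tenfold part. [folklore] -/
theorem IsTenPartM.injOn {m m' : Fin r} {G : Finset α} (hG : IsTenPartM v m m' G) : Set.InjOn v ↑G := by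
  classical
  intro x hx x' hx' h
  have hle : (G.filter fun y => v y = v x).card ≤ 1 := by
    rw [hG.count_eq]; split_ifs <;> omega
  exact Finset.card_le_one.1 hle x (Finset.mem_filter.2 ⟨hx, rfl⟩) x' (Finset.mem_filter.2 ⟨hx', h.symm⟩)

/-- A tenfold part is non-empty. [folklore] -/
theorem IsTenPartM.nonempty {m m' : Fin r} {G : Finset α} (hG : IsTenPartM v m m' G) : G.Nonempty := by
  rw [← Finset.card_pos, hG.1]; norm_num


/-! ### Sixfold and tenfold parts from the counts -/

/-- A sixfold part inside `T` from the counts: one point over `inl b` and one over each `(m, a, b)`. [folklore] -/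
theorem exists_sixPartM_of_counts [DecidableEq α] {T : Finset α} (m : Fin r) (b : Bool)
    (hE : 0 < (T.filter fun x => v x = Sum.inl b).card)
    (hB : ∀ a : Fin 5, 0 < (T.filter fun x => v x = Sum.inr (m, (a, b))).card) : ∃ G ⊆ T, IsSixPartM v m b G := by
  obtain ⟨x, hx⟩ := Finset.card_pos.1 hE
  obtain ⟨hxT, hvx⟩ := Finset.mem_filter.1 hx
  obtain ⟨W, hWT, hW⟩ := exists_fivePartM_of_counts (v := v) (T := T) m b hB
  have hxW : x ∉ W := fun h => by
    obtain ⟨a, ha⟩ := hW.exists_eq_inr h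
    rw [hvx] at ha; exact Sum.inl_ne_inr ha
  refine ⟨insert x W, Finset.insert_subset hxT hWT, ?_, ?_, fun a => ?_⟩
  · rw [Finset.card_insert_of_notMem hxW, hW.1]
  · rw [Finset.filter_insert, if_pos hvx, Finset.filter_false_of_mem fun z hz => ?_, Finset.card_insert_of_notMem (by simp)]
    · rfl
    · obtain ⟨a, ha⟩ := hW.exists_eq_inr hz
      rw [ha]; exact Sum.inr_ne_inl
  · rw [Finset.filter_insert, if_neg (by rw [hvx]; exact Sum.inl_ne_inr), hW.2 a]

/-- A tenfold part inside `T` from the counts: one point over each `(m, a, true)` and each `(m', a, false)`. [folklore] -/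
theorem exists_tenPartM_of_counts [DecidableEq α] {T : Finset α} (m m' : Fin r)
    (h0 : ∀ a : Fin 5, 0 < (T.filter fun x => v x = Sum.inr (m, (a, true))).card)
    (h1 : ∀ a : Fin 5, 0 < (T.filter fun x => v x = Sum.inr (m', (a, false))).card) : ∃ G ⊆ T, IsTenPartM v m m' G := by
  obtain ⟨W₀, hW₀T, hW₀⟩ := exists_fivePartM_of_counts (v := v) (T := T) m true h0
  obtain ⟨W₁, hW₁T, hW₁⟩ := exists_fivePartM_of_counts (v := v) (T := T) m' false h1
  have hW : Disjoint W₀ W₁ := by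
    rw [Finset.disjoint_left]
    intro x hx0 hx1
    obtain ⟨a, ha⟩ := hW₀.exists_eq_inr hx0
    obtain ⟨a', ha'⟩ := hW₁.exists_eq_inr hx1
    have := ha.symm.trans ha'
    simp at this
  refine ⟨W₀ ∪ W₁, Finset.union_subset hW₀T hW₁T, ?_, fun a => ?_, fun a => ?_⟩
  · rw [Finset.card_union_of_disjoint hW, hW₀.1, hW₁.1]
  · rw [Finset.filter_union, Finset.filter_false_of_mem (s := W₁) fun x hx => ?_, Finset.union_empty, hW₀.2 a]
    obtain ⟨a', ha'⟩ := hW₁.exists_eq_inr hx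
    rw [ha']; simp
  · rw [Finset.filter_union, Finset.filter_false_of_mem (s := W₀) fun x hx => ?_, Finset.empty_union, hW₁.2 a]
    obtain ⟨a', ha'⟩ := hW₀.exists_eq_inr hx
    rw [ha']; simp

/-! ### Extraction and induction -/

section Extraction

variable (hP : ∀ m, ((univ : Finset (Fin 5)).filter fun a => P m a = true).card = 2) (hind : IndepPos P)
  (hmul : ∀ π₁ ∈ R, ∀ π₂ ∈ R, π₁ * π₂ ∈ R) (h2 : ∀ a b x y : Fin 5, a ≠ b → x ≠ y → ∃ π ∈ R, π a = x ∧ π b = y)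

include hP hind hmul h2 in
/-- **EXTRACTION.**  Under `#I_m = 2`, `IndepPos P` and `R` closed under composition and `2`-transitive, a non-empty `R`-balanced
configuration contains a pair part, a sixfold part, or a tenfold part: by the defect law, two slots with defects of strictly opposite
signs give a tenfold part; otherwise all non-zero defects share a sign, which is then the sign of `e = Σ_m t_m`, and a slot with
non-zero defect gives a sixfold part; if all defects vanish, `e = 0` and the counts are conjugation-invariant — a pair part.
[cite: Milne2020HodgeClassesAV, 1.2 (a) and Thm. 1] [cite: MoonenZarhin1995Duke, Thm. 2.4] -/
theorem exists_part_of_modelBalancedM [DecidableEq α] {T : Finset α} (hT : ModelBalancedM P R v T) (hne : T.Nonempty) :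
    ∃ G ⊆ T, IsPairPartM v G ∨ (∃ m b, IsSixPartM v m b G) ∨ ∃ m m', IsTenPartM v m m' G := by
  obtain ⟨t, ht, hE⟩ := exists_defectM_of_modelBalancedM hP hind hmul h2 hT
  -- the tenfold case: two defects of strictly opposite signs
  by_cases h10 : ∃ m m' : Fin r, 0 < t m ∧ t m' < 0
  · obtain ⟨m, m', hm, hm'⟩ := h10
    obtain ⟨G, hG, h⟩ := exists_tenPartM_of_counts (v := v) (T := T) m m'
      (fun a => by have h := ht m a; omega) (fun a => by have h := ht m' a; omega)
    exact ⟨G, hG, Or.inr (Or.inr ⟨m, m', h⟩)⟩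
  -- a sixfold part of positive sign
  by_cases hpos : ∃ m : Fin r, 0 < t m
  · obtain ⟨m, hm⟩ := hpos
    have hnn : ∀ m' : Fin r, 0 ≤ t m' := fun m' => by
      by_contra h
      exact h10 ⟨m, m', hm, by omega⟩
    have hm3 : t m ≤ ∑ m' : Fin r, t m' := Finset.single_le_sum (fun m' _ => hnn m') (Finset.mem_univ m)
    obtain ⟨G, hG, hS⟩ := exists_sixPartM_of_counts (v := v) (T := T) m true (by omega) fun a => by
      have h := ht m a; omega
    exact ⟨G, hG, Or.inr (Or.inl ⟨m, true, hS⟩)⟩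
  -- a sixfold part of negative sign
  by_cases hneg : ∃ m : Fin r, t m < 0
  · obtain ⟨m, hm⟩ := hneg
    have hnp : ∀ m' : Fin r, t m' ≤ 0 := fun m' => by
      by_contra h
      exact h10 ⟨m', m, by omega, hm⟩
    have hm3 : ∑ m' : Fin r, t m' ≤ t m := by
      have h := Finset.single_le_sum (f := fun m' => -t m') (fun m' _ => by have h' := hnp m'; omega) (Finset.mem_univ m)
      rw [Finset.sum_neg_distrib] at h
      omega
    obtain ⟨G, hG, hS⟩ := exists_sixPartM_of_counts (v := v) (T := T) m false (by omega) fun a => by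
      have h := ht m a; omega
    exact ⟨G, hG, Or.inr (Or.inl ⟨m, false, hS⟩)⟩
  -- all `t_m = 0`: conjugation-invariant counts, a pair part
  have htm : ∀ m : Fin r, t m = 0 := fun m => by
    have h1 : ¬ 0 < t m := fun h => hpos ⟨m, h⟩
    have h2 : ¬ t m < 0 := fun h => hneg ⟨m, h⟩
    omega
  have hz : ∀ (m : Fin r) (a : Fin 5), (T.filter fun x => v x = Sum.inr (m, (a, true))).card =
      (T.filter fun x => v x = Sum.inr (m, (a, false))).card := by
    intro m a
    have h := ht m a
    rw [htm m] at h
    omega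
  have hsum : ∑ m : Fin r, t m = 0 := Finset.sum_eq_zero fun m _ => htm m
  have hEE : (T.filter fun x => v x = Sum.inl true).card = (T.filter fun x => v x = Sum.inl false).card := by
    rw [hsum] at hE; omega
  obtain ⟨x, hx⟩ := hne
  have hNx : 0 < (T.filter fun x' => v x' = v x).card := Finset.card_pos.2 ⟨x, Finset.mem_filter.2 ⟨hx, rfl⟩⟩
  have hNcx : 0 < (T.filter fun x' => v x' = cjM (v x)).card := by
    rcases hvx : v x with s | ⟨m, ⟨a, s⟩⟩ <;> rw [hvx] at hNx
    · cases s
      · rw [cjM_inl, Bool.not_false]; omega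
      · rw [cjM_inl, Bool.not_true]; omega
    · have h := hz m a
      cases s
      · rw [cjM_inr, Bool.not_false]; omega
      · rw [cjM_inr, Bool.not_true]; omega
  obtain ⟨G, hG, hP'⟩ := exists_pairPartM_of_counts (y := v x) hNx hNcx
  exact ⟨G, hG, Or.inl hP'⟩

include hP hind hmul h2 in
/-- **INDUCTION PRINCIPLE FOR BALANCED CONFIGURATIONS (any number of copies of `E, B₁, …, B_r`).**  If `motive` holds for `∅` and
passes from `S` to `G ∪ S` for `G` disjoint from `S` a pair part, a sixfold part, or a tenfold part, then `motive` holds for every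
`R`-balanced configuration. [cite: Milne2020HodgeClassesAV, 1.2 (a) and Thm. 1] [cite: GaoUllmo2025, Thm 3.1] -/
theorem modelBalancedM_induction [DecidableEq α] {motive : Finset α → Prop} (h0 : motive ∅)
    (hpair : ∀ G S : Finset α, Disjoint G S → IsPairPartM v G → motive S → motive (G ∪ S))
    (hsix : ∀ (G S : Finset α) (m : Fin r) (b : Bool), Disjoint G S → IsSixPartM v m b G → motive S → motive (G ∪ S))
    (hten : ∀ (G S : Finset α) (m m' : Fin r), Disjoint G S → IsTenPartM v m m' G → motive S → motive (G ∪ S))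
    {T : Finset α} (hT : ModelBalancedM P R v T) : motive T := by
  induction T using Finset.strongInduction with
  | H T ih =>
    by_cases hTe : T = ∅
    · subst hTe; exact h0
    obtain ⟨G, hGT, hG⟩ := exists_part_of_modelBalancedM hP hind hmul h2 hT (Finset.nonempty_iff_ne_empty.2 hTe)
    rcases hG with hPG | ⟨m, b, hS⟩ | ⟨m, m', h10⟩
    · have hR : ModelBalancedM P R v (T \ G) := hT.sdiff (fun π _ => hPG.balancedM P hP π) hGT
      have hlt : T \ G ⊂ T := Finset.sdiff_ssubset hGT hPG.nonempty
      have h := hpair G (T \ G) Finset.disjoint_sdiff hPG (ih _ hlt hR)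
      rwa [Finset.union_sdiff_of_subset hGT] at h
    · have hR : ModelBalancedM P R v (T \ G) := hT.sdiff (fun π _ => hS.balancedM P hP π) hGT
      have hlt : T \ G ⊂ T := Finset.sdiff_ssubset hGT hS.nonempty
      have h := hsix G (T \ G) m b Finset.disjoint_sdiff hS (ih _ hlt hR)
      rwa [Finset.union_sdiff_of_subset hGT] at h
    · have hR : ModelBalancedM P R v (T \ G) := hT.sdiff (fun π _ => h10.balancedM P hP π) hGT
      have hlt : T \ G ⊂ T := Finset.sdiff_ssubset hGT h10.nonempty
      have h := hten G (T \ G) m m' Finset.disjoint_sdiff h10 (ih _ hlt hR)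
      rwa [Finset.union_sdiff_of_subset hGT] at h

end Extraction

end Summit.HodgeConjecture.CorCM.Census.DecicWeil23Multi
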